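import Literature.AnabelianGeometry.EtaleTheta.Thm56SubdagStatements
import Mathlib.Data.ZMod.QuotientGroup

/-!
# [EtTh] Prop. 5.5 — «induce isomorphisms»: the cardinality upgrade of the transport step (PDF p.102 = printed p.328)

Mochizuki, *The étale theta function …*, Publ. RIMS **45** (2009)
[cite: MochizukiEtTh2009, Prop 5.5 proof p.328 (PDF p.102)].  abc-iut cell, layer L2, §K row K4 (seat abc-iut-w5-d020
gen 2); PROOF-ONLY (no definitions), over `Thm56SubdagStatements.lean` (this seat) and abc-iut-L2-t4's
`FrobenioidCyclotomicRigidity.lean` / `FrobenioidTheta.lean`.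

Sub-node **P55-L05** of plan/L2/SUBDAG-EtTh-Thm56.md: print transports the isomorphism of Prop. 5.5 along «linear
morphisms `S″ → S` … which induce isomorphisms `(l·Δ_Θ)_{S″} ⊗ ℤ/Nℤ ⥲ (l·Δ_Θ)_S ⊗ ℤ/Nℤ`; … `μ_N(S) ⥲ μ_N(S″)`».
abc-iut-L2-t4 typed the transport step as `LinearlyReachableFromBN` (Δ-push ONTO, μ-pull INJECTIVE); this file
PROVES that under Def. 5.4 at both ends («(a) `S` is `μ_{l·N}`-saturated; (b) `(l·Δ_Θ)_S ⊗ ℤ/Nℤ` is of cardinality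
`N`») both induced maps are BIJECTIVE (`bijectivelyReachableFromBN_of`), i.e. t4's input implies the form
`BijectivelyReachableFromBN` consumed by `Thm56SubdagProofs.rigidityFamily_exists_of`.  The count behind it:
`Nat.card μ_N(S) = N` for a `μ_{l·N}`-saturated `S` (`card_muTorsion_eq`: the `N`-torsion of a cyclic group of
order `l·N`), from the elementary `ZMod` count `natCard_nsmul_eq_zero_zmod`.
HONEST FRAMING: kernel-checked implications between typed statements about the §5 data; nothing of [EtTh] is
asserted unconditionally; typed ≠ discharged; no side taken on [IUTchIII] Cor. 3.12.
-/

namespace Literature.AnabelianGeometry.EtaleTheta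

open CategoryTheory
open FrobenioidCyclotomicRigidity

universe w v v' u u'

namespace ThetaFrobenioid

namespace Thm56Sub

/-! ### The `N`-torsion of `ℤ/l·Nℤ` has exactly `N` elements -/

/-- In `ℤ/(l·N)ℤ` (`l, N ≥ 1`) the solutions of `N·x = 0` are exactly `N` in number (they are the multiples of
`l`).  Counted through the endomorphism `x ↦ N·x`, whose image is generated by `N` and has order `l`.
[cite: MochizukiEtTh2009, Def 5.4 p.327 (PDF p.101)] -/
theorem natCard_nsmul_eq_zero_zmod {l N : ℕ} (hl : 0 < l) (hN : 0 < N) :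
    Nat.card {x : ZMod (l * N) // N • x = 0} = N := by
  haveI : NeZero (l * N) := ⟨(Nat.mul_pos hl hN).ne'⟩
  set f : ZMod (l * N) →+ ZMod (l * N) := AddMonoidHom.mulLeft ((N : ℕ) : ZMod (l * N)) with hf
  have hker : Nat.card {x : ZMod (l * N) // N • x = 0} = Nat.card f.ker := by
    refine Nat.card_congr (Equiv.subtypeEquivRight fun x => ?_)
    rw [AddMonoidHom.mem_ker, nsmul_eq_mul]
    rfl
  -- the image of `x ↦ N·x` is the cyclic subgroup generated by `N`, of order `l`
  have hrange : f.range = AddSubgroup.zmultiples ((N : ℕ) : ZMod (l * N)) := by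
    ext y
    constructor
    · rintro ⟨x, rfl⟩
      refine ⟨(x.val : ℤ), ?_⟩
      change ((x.val : ℤ)) • ((N : ℕ) : ZMod (l * N)) = (N : ZMod (l * N)) * x
      rw [zsmul_eq_mul, Int.cast_natCast, ZMod.natCast_zmod_val]
      exact mul_comm _ _
    · rintro ⟨k, rfl⟩
      refine ⟨(k : ZMod (l * N)), ?_⟩
      change (N : ZMod (l * N)) * ((k : ZMod (l * N))) = k • ((N : ℕ) : ZMod (l * N))
      rw [zsmul_eq_mul]
      exact mul_comm _ _
  have hcard_range : Nat.card f.range = l := by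
    rw [hrange, Nat.card_zmultiples, ZMod.addOrderOf_coe N (NeZero.ne (l * N)),
      Nat.gcd_eq_right (dvd_mul_left N l), Nat.mul_div_cancel _ hN]
  -- |G| = |G/ker| · |ker| and G/ker ≅ range
  have htot : Nat.card (ZMod (l * N)) = Nat.card (ZMod (l * N) ⧸ f.ker) * Nat.card f.ker :=
    AddSubgroup.card_eq_card_quotient_mul_card_addSubgroup f.ker
  rw [Nat.card_zmod, Nat.card_congr (QuotientAddGroup.quotientKerEquivRange f).toEquiv, hcard_range] at htot
  rw [hker]
  exact (Nat.eq_of_mul_eq_mul_left hl htot).symm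

variable {C : Type u} [Category.{v} C] {D : Type u'} [Category.{v'} D] (𝔉 : ThetaFrobenioid.{w} C D)

/-! ### `Nat.card μ_N(S) = N` for a `μ_{l·N}`-saturated `S` (Def. 5.4 (a)) -/

/-- **«μ_N(S) (= l·μ_{l·N}(S))»** (Prop. 5.5, p.327 (PDF p.101)): for a `μ_{l·N}`-saturated `S` ([FrdII] Def. 2.1 (i):
`μ_{l·N}(S) ≅ ℤ/l·Nℤ`) the cyclotome `μ_N(S)` — the `N`-torsion of `O^×(S)`, automatically inside `μ_{l·N}(S)` — has
exactly `N` elements.  [cite: MochizukiEtTh2009, Prop 5.5 p.327 (PDF p.101)] -/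
theorem card_muTorsion_eq (hl : 0 < 𝔉.l) {S : C} (hsat : 𝔉.IsMuSaturated S (𝔉.l * 𝔉.N)) :
    Nat.card (𝔉.muTorsion S 𝔉.N) = 𝔉.N := by
  obtain ⟨e⟩ := hsat
  have hN : 0 < (𝔉.N : ℕ) := 𝔉.N.pos
  -- `μ_N(S) ⊆ μ_{l·N}(S)`
  have hincl : ∀ u : 𝔉.muTorsion S 𝔉.N, (u : Aut S) ∈ 𝔉.muTorsion S (𝔉.l * 𝔉.N) := fun u =>
    ⟨u.2.1, by rw [pow_mul', u.2.2, one_pow]⟩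
  -- the bijection `μ_N(S) ≃ {x : ℤ/l·N | N·x = 0}` through `e`
  let toZ : 𝔉.muTorsion S 𝔉.N → {x : ZMod (𝔉.l * 𝔉.N) // (𝔉.N : ℕ) • x = 0} := fun u =>
    ⟨Multiplicative.toAdd (e ⟨u, hincl u⟩), by
      have hpow : (⟨(u : Aut S), hincl u⟩ : 𝔉.muTorsion S (𝔉.l * 𝔉.N)) ^ (𝔉.N : ℕ) = 1 :=
        Subtype.ext u.2.2
      rw [← toAdd_pow, ← map_pow, hpow, map_one, toAdd_one]⟩
  let ofZ : {x : ZMod (𝔉.l * 𝔉.N) // (𝔉.N : ℕ) • x = 0} → 𝔉.muTorsion S 𝔉.N := fun x =>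
    ⟨(e.symm (Multiplicative.ofAdd x.1) : Aut S), (e.symm (Multiplicative.ofAdd x.1)).2.1, by
      have h1 : e.symm (Multiplicative.ofAdd x.1) ^ (𝔉.N : ℕ) = 1 := by
        rw [← map_pow, ← ofAdd_nsmul, x.2, ofAdd_zero, map_one]
      have h2 := congrArg (fun g : 𝔉.muTorsion S (𝔉.l * 𝔉.N) => (g : Aut S)) h1
      simpa using h2⟩
  have hEq : Nat.card (𝔉.muTorsion S 𝔉.N) = Nat.card {x : ZMod (𝔉.l * 𝔉.N) // (𝔉.N : ℕ) • x = 0} := by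
    refine Nat.card_congr ⟨toZ, ofZ, fun u => ?_, fun x => ?_⟩
    · apply Subtype.ext
      change ((e.symm (Multiplicative.ofAdd (Multiplicative.toAdd (e ⟨u, hincl u⟩))) :
        𝔉.muTorsion S (𝔉.l * 𝔉.N)) : Aut S) = u
      rw [ofAdd_toAdd, MulEquiv.symm_apply_apply]
    · apply Subtype.ext
      change Multiplicative.toAdd (e ⟨(e.symm (Multiplicative.ofAdd x.1) : Aut S), _⟩) = x.1
      have : (⟨(e.symm (Multiplicative.ofAdd x.1) : Aut S), hincl (ofZ x)⟩ :
          𝔉.muTorsion S (𝔉.l * 𝔉.N)) = e.symm (Multiplicative.ofAdd x.1) := Subtype.ext rfl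
      rw [this, MulEquiv.apply_symm_apply, toAdd_ofAdd]
  rw [hEq, natCard_nsmul_eq_zero_zmod hl hN]

/-! ### P55-L05: t4's transport step + Def. 5.4 ⇒ the induced maps are isomorphisms -/

/-- **EtTh:Prop5.5/P55-L05 — «which induce isomorphisms», DERIVED**: abc-iut-L2-t4's `LinearlyReachableFromBN`
(every `(l, N)`-theta-saturated `S` receives a linear `φ : B_N → S` with `Δ-push(φ)` onto and `μ-pull(φ)` injective)
implies `BijectivelyReachableFromBN` when `B_N` is `(l, N)`-theta-saturated: by Def. 5.4 (b) both
`(l·Δ_Θ) ⊗ ℤ/Nℤ` have `N` elements, and by Def. 5.4 (a) both `μ_N` have `N` elements (`card_muTorsion_eq`), so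
a surjection resp. an injection between them is a bijection (abc-iut-L2-t9's «surjections between finite groups of
equal order» shape, `ThetaSubquotient.modPowMap_bijective_of_card_eq`).  (`l ≥ 1`: `l` is odd.)
[cite: MochizukiEtTh2009, Prop 5.5 proof p.328 (PDF p.102)] -/
theorem bijectivelyReachableFromBN_of (hB : 𝔉.IsThetaSaturated 𝔉.BN) (hreach : LinearlyReachableFromBN 𝔉) :
    BijectivelyReachableFromBN 𝔉 := by
  have hl : 0 < 𝔉.l := 𝔉.odd_l.pos
  intro S hS
  obtain ⟨φ, hφ, hsurj, hinj⟩ := hreach S hS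
  refine ⟨φ, hφ, ?_, ?_⟩
  · -- Δ-side: onto + equal finite cardinalities (Def. 5.4 (b))
    haveI : Finite (𝔉.lDeltaModN 𝔉.BN) :=
      Nat.finite_of_card_ne_zero (by rw [hB.card_lDeltaModN]; exact 𝔉.N.ne_zero)
    exact hsurj.bijective_of_nat_card_le (by rw [hB.card_lDeltaModN, hS.card_lDeltaModN])
  · -- μ-side: injective + equal finite cardinalities (Def. 5.4 (a))
    haveI : Finite (𝔉.muTorsion 𝔉.BN 𝔉.N) :=
      Nat.finite_of_card_ne_zero (by rw [card_muTorsion_eq 𝔉 hl hB.muSaturated]; exact 𝔉.N.ne_zero)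
    exact hinj.bijective_of_nat_card_le
      (by rw [card_muTorsion_eq 𝔉 hl hB.muSaturated, card_muTorsion_eq 𝔉 hl hS.muSaturated])

end Thm56Sub

end ThetaFrobenioid

end Literature.AnabelianGeometry.EtaleTheta
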